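import Literature.AlgebraicGeometry.Motives.AbelianVarietyInducedActionMackey
import HarnessLib

/-!
# Mackey's restriction formula for the ISOTYPICAL components of `Res_L Ind_H^G Y`, the vanishing of the induced
# character off the conjugates of `H`, and the isogenies `B_H(Res_H Ind_H^G Y) ∼ B_H(Y)^{[G:H]}` (`H ⊴ G`),
# `B_L(Res_L Ind_H^G Y) ∼ Y^m` (`L ∩ xHx⁻¹ = 1`)

Sequel of `Motives/AbelianVarietyInducedActionMackey`.  `X = ⊕_{t ∈ T} Y_t = Ind_H^G (Y, α)` is an induced action on a power
of an abelian variety over a field `K` (bicone `b` with `Σ_t π_t ≫ ι_t = 𝟙`, action `ρ : G → End X` with `ι_t ρ(g) π_u = 0` for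
`u ≠ g t`, `T` transitive, `H = Stab(t₀)`, `α(h) = ι_{t₀} ρ(h) π_{t₀}`), `L ≤ G` a subgroup.  This file proves (no definition):

* §1 **the induced character vanishes off the conjugates of `H`**: if `g` fixes no point of `T` (no conjugate of `g` lies
  in `H`) then `Tr(ρ(g) | T_ℓ X) = 0` and `χ_B(ρ(g)) = 0` on `Hom(−, B)` ("`χ_ρ(u)` is a linear combination of the
  `χ_θ(r⁻¹ur)` with `r⁻¹ur ∈ H`", Thm. 12);
* §2 MACKEY'S FORMULA FOR THE `L`-ISOTYPICAL COMPONENTS `B_W^L(Res_L X) = Im u_W`, `u_W = Σ_{l ∈ L} c_W(l) ρ(l)`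
  (`W ∈ Irr_ℚ(L)`, `|L| e_W = Σ_l c_W(l) l`): **`|H| · |L| · 2 dim B_W^L(Res_L X) = Σ_{x ∈ G} Σ_{h ∈ H} Σ_{l ∈ L, l = xhx⁻¹} c_W(l) Tr(α(h) | T_ℓ Y)`**
  (`ℓ` invertible in `K`; the weight-`c` Mackey formula of the prequel with `c = c_W` extended by zero and the tree's
  `card_mul_two_mul_dim_isotypical_eq_sum` for `ρ|_L` — Prop. 22 projected by Thm. 8: `dim B_W^L = ½ ⟨Res_L Ind_H^G χ_Y, |L| e_W⟩`
  evaluated on `H`), the vanishing criterion **`B_W^L(Res_L X) = 0 ⟺` that sum is `0`**, and the `Hom(−, B)` form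
  **`|H| · |L| · rk_ℤ Hom(B_W^L(Res_L X), B) = Σ_x Σ_h Σ_{l = xhx⁻¹} c_W(l) χ_B(α(h))`** over any field;
* §3 over a PERFECT field the Hom-counts of the prequel become isogenies: **`B_H(Res_H Ind_H^G Y) ∼ B_H(Y)^{[G:H]}`** for
  `H ⊴ G` ("`H_s = H`, `Res_H V = ⊕_{s ∈ G/H} W_s`", and `W_s^H ≅ W^H`), and **`B_L(Res_L Ind_H^G Y) ∼ Y^m`**, `|T| = |L| m`,
  when every `L ∩ xHx⁻¹` is trivial (`Res_L X` is a sum of `m` regular powers `Ind_1^L Y`, each with fixed part `≅ Y`).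

## References

* [SerreLinearRepresentations1977] J.-P. Serre, *Linear Representations of Finite Groups*, GTM 42 (1977): §2.6 Thm. 8
  (isotypical projectors), §3.3 Thm. 12 and Example 1, §7.2 Thm. 13, §7.3 Prop. 22, §7.4 Cor.  Held:
  `book:serre1977-linear-representations-finite-groups`, PDF pp. 30–31, 50–54 read 2026-08-28.
* [LangeRodriguez2022] H. Lange, R. E. Rodríguez, *Decomposition of Jacobians by Prym Varieties*, LNM 2310 (2022), §2.9.1
  Thm. 2.9.1, Prop. 2.9.3 (PDF pp. 43, 46: `dim B_W` and `B_W = 0 ⟺ ⟨ρ, W⟩ = 0`), §3.5.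
* [KaniRosen1989] E. Kani, M. Rosen, *Idempotent relations and factors of Jacobians*, Math. Ann. 284 (1989), §2, §3 Thm. B.
* [Milne1986AbelianVarieties] J. S. Milne, *Abelian Varieties* (1986), §12 (Hom-counts and isogeny classes, p. 122).
* [MumfordAV1970] D. Mumford, *Abelian Varieties* (1970), §19 Thm. 3 (p. 176), Thm. 4 (p. 180).
-/

noncomputable section

open CategoryTheory CategoryTheory.Limits MulAction
open Literature.NumberTheory.DiophantineGeometry
open Literature.RepresentationTheory.FiniteGroups

universe u

namespace Literature.AlgebraicGeometry.Motives

namespace AbelianVariety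

namespace Imprimitive

variable {K : Type u} [Field K]

/-! ## §1 The induced character vanishes off the conjugates of `H` -/

section Vanishing

variable (ℓ : ℕ) [Fact ℓ.Prime] {Y : AbelianVariety K} (B : AbelianVariety K) {T : Type} [Fintype T]
  (b : Bicone (fun _ : T ↦ Y)) {G : Type} [Group G] [MulAction G T] (ρ : G →* End b.pt)

/-- **`χ_X(g) = 0` if `g` fixes no summand**: for an action permuting the summands of `X = ⊕_t Y_t` along `T` and `g ∈ G`
with `g t ≠ t` for all `t` (for `T = G/H`: no conjugate of `g` lies in `H`), `Tr(ρ(g) | T_ℓ X) = 0` (`ℓ` invertible in `K`) —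
the character of `Ind_H^G W` is supported on `⋃_x xHx⁻¹`. [cite: SerreLinearRepresentations1977, §3.3 Thm. 12] [cite: MumfordAV1970, §19 Thm. 4 (p. 180)] -/
theorem trace_tateModuleMap_asHom_eq_zero_of_forall_smul_ne (hb : ∑ t, b.π t ≫ b.ι t = 𝟙 b.pt)
    (hρ : ∀ (g : G) (t u : T), g • t ≠ u → b.ι t ≫ End.asHom (ρ g) ≫ b.π u = 0) (hℓ : (ℓ : K) ≠ 0) {g : G}
    (hg : ∀ t : T, g • t ≠ t) :
    LinearMap.trace ℤ_[ℓ] (b.pt.tateModule ℓ) (tateModuleMap ℓ (End.asHom (ρ g))) = 0 := by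
  classical
  rw [trace_tateModuleMap_asHom_eq_sum_filter ℓ b ρ hb hρ hℓ g]
  exact Finset.sum_eq_zero fun t ht ↦ absurd (Finset.mem_filter.1 ht).2 (hg t)

omit [Fact ℓ.Prime] in
/-- **`χ_B(ρ(g)) = 0` on `Hom(−, B)` if `g` fixes no summand** (any field): `tr_ℤ(ρ(g) ∘ − | Hom(X, B)) = 0` for `g` with
`g t ≠ t` for all `t ∈ T`. [cite: SerreLinearRepresentations1977, §3.3 Thm. 12] [cite: KaniRosen1989, §2] -/
theorem trace_leftComp_asHom_eq_zero_of_forall_smul_ne (hb : ∑ t, b.π t ≫ b.ι t = 𝟙 b.pt)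
    (hρ : ∀ (g : G) (t u : T), g • t ≠ u → b.ι t ≫ End.asHom (ρ g) ≫ b.π u = 0) {g : G}
    (hg : ∀ t : T, g • t ≠ t) :
    LinearMap.trace ℤ (b.pt ⟶ B) (Preadditive.leftComp B (End.asHom (ρ g))).toIntLinearMap = 0 := by
  classical
  rw [trace_leftComp_asHom_eq_sum_filter B b ρ hb hρ g]
  exact Finset.sum_eq_zero fun t ht ↦ absurd (Finset.mem_filter.1 ht).2 (hg t)

end Vanishing

/-! ## §2 Mackey's formula for the `L`-isotypical components of `Res_L Ind_H^G Y` -/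

section Isotypical

variable (ℓ : ℕ) [Fact ℓ.Prime] {Y : AbelianVariety K} (B : AbelianVariety K) {T : Type} [Fintype T]
  (b : Bicone (fun _ : T ↦ Y)) {G : Type} [Group G] [Fintype G] [MulAction G T] [IsPretransitive G T]
  (ρ : G →* End b.pt) (t₀ : T) [Fintype (stabilizer G t₀)] (α : stabilizer G t₀ →* End Y)
  (L : Subgroup G) [Fintype L] [DecidableEq G]
  {cL : ratCharIdempotents L → L → ℤ}
  (hcL : ∀ e : ratCharIdempotents L,
    (Fintype.card L : ℚ) • (e : MonoidAlgebra ℚ L) = ∑ l, (cL e l : ℚ) • MonoidAlgebra.of ℚ L l)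
  {uL : ratCharIdempotents L → (b.pt ⟶ b.pt)} (huL : ∀ e, End.of (uL e) = ∑ l : L, cL e l • (ρ.comp L.subtype) l)

include hcL huL

/-- **Mackey's formula for the `L`-isotypical components of the restriction, `ℓ`-adic form**: for `W ∈ Irr_ℚ(L)` with
integral projector data `|L| e_W = Σ_{l ∈ L} c_W(l) l`, `u_W = Σ_l c_W(l) ρ(l)`, `B_W^L(Res_L X) = Im u_W` (`ℓ` invertible in `K`),
**`|H| · |L| · 2 dim B_W^L(Res_L Ind_H^G Y) = Σ_{x ∈ G} Σ_{h ∈ H} Σ_{l ∈ L, l = xhx⁻¹} c_W(l) Tr(α(h) | T_ℓ Y)`** —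
`|L| · 2 dim B_W^L = Σ_l c_W(l) χ_X(l)` (Thm. 8 / LR Prop. 2.9.3 for `ρ|_L`) and the prequel's weight-`c_W` Mackey formula:
the multiplicity of `W` in `Res_L Ind_H^G χ_Y` computed on `H` double coset by double coset.
[cite: SerreLinearRepresentations1977, §7.3 Prop. 22 and §2.6 Thm. 8] [cite: LangeRodriguez2022, §2.9.1 Prop. 2.9.3 (PDF p. 46)] -/
theorem card_stabilizer_mul_card_mul_two_mul_dim_isotypical_restrict_eq_sum (hb : ∑ t, b.π t ≫ b.ι t = 𝟙 b.pt)
    (hρ : ∀ (g : G) (t u : T), g • t ≠ u → b.ι t ≫ End.asHom (ρ g) ≫ b.π u = 0) (hℓ : (ℓ : K) ≠ 0)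
    (hα : ∀ h : stabilizer G t₀, End.asHom (α h) = b.ι t₀ ≫ End.asHom (ρ h) ≫ b.π t₀) (e : ratCharIdempotents L) :
    ((Fintype.card (stabilizer G t₀) * (Fintype.card L * (2 * (image (uL e)).dim)) : ℕ) : ℤ_[ℓ]) =
      ∑ x : G, ∑ h : stabilizer G t₀, ∑ l : L, (if (l : G) = x * h * x⁻¹ then
        (cL e l : ℤ_[ℓ]) * LinearMap.trace ℤ_[ℓ] (Y.tateModule ℓ) (tateModuleMap ℓ (End.asHom (α h))) else 0) := by
  classical
  -- `c_W` extended by zero to `G`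
  set c : G → ℤ_[ℓ] := fun g ↦ ∑ l : L, (if (l : G) = g then (cL e l : ℤ_[ℓ]) else 0) with hc
  have hcl : ∀ l₀ : L, c l₀ = cL e l₀ := fun l₀ ↦ by
    simp only [hc, SetLike.coe_eq_coe, Finset.sum_ite_eq', Finset.mem_univ, if_true]
  have h1 := card_mul_two_mul_dim_isotypical_eq_sum ℓ (ρ.comp L.subtype) hcL huL hℓ e
  have h2 := card_stabilizer_mul_sum_subgroup_mul_trace_eq ℓ b ρ t₀ α L hb hρ hℓ hα c
  have h3 : ∑ l : L, c l * LinearMap.trace ℤ_[ℓ] (b.pt.tateModule ℓ) (tateModuleMap ℓ (End.asHom (ρ l))) =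
      ((Fintype.card L * (2 * (image (uL e)).dim) : ℕ) : ℤ_[ℓ]) := by
    rw [h1]
    exact Finset.sum_congr rfl fun l _ ↦ by rw [hcl]; rfl
  rw [h3] at h2
  rw [Nat.cast_mul, h2]
  refine Finset.sum_congr rfl fun x _ ↦ Finset.sum_congr rfl fun h _ ↦ ?_
  split_ifs with hmem
  · simp only [hc, Finset.sum_mul, ite_mul, zero_mul]
  · symm
    exact Finset.sum_eq_zero fun l _ ↦ if_neg fun (hl : (l : G) = x * h * x⁻¹) ↦ hmem (hl ▸ l.2)

/-- **Vanishing criterion for the `L`-isotypical components of the restriction**: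
`B_W^L(Res_L Ind_H^G Y) = 0 ⟺ Σ_{x ∈ G} Σ_{h ∈ H} Σ_{l ∈ L, l = xhx⁻¹} c_W(l) Tr(α(h) | T_ℓ Y) = 0`
("`dim B = 0` if and only if `⟨ρ, W⟩ = 0`", with `⟨Res_L Ind_H^G χ_Y, W⟩_L` evaluated on `H`).
[cite: LangeRodriguez2022, §2.9.1 Thm. 2.9.1 and Prop. 2.9.3 (ii) (PDF pp. 43, 46)] [cite: SerreLinearRepresentations1977, §7.3 Prop. 22] -/
theorem dim_isotypical_restrict_eq_zero_iff (hb : ∑ t, b.π t ≫ b.ι t = 𝟙 b.pt)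
    (hρ : ∀ (g : G) (t u : T), g • t ≠ u → b.ι t ≫ End.asHom (ρ g) ≫ b.π u = 0) (hℓ : (ℓ : K) ≠ 0)
    (hα : ∀ h : stabilizer G t₀, End.asHom (α h) = b.ι t₀ ≫ End.asHom (ρ h) ≫ b.π t₀) (e : ratCharIdempotents L) :
    (image (uL e)).dim = 0 ↔
      ∑ x : G, ∑ h : stabilizer G t₀, ∑ l : L, (if (l : G) = x * h * x⁻¹ then
        (cL e l : ℤ_[ℓ]) * LinearMap.trace ℤ_[ℓ] (Y.tateModule ℓ) (tateModuleMap ℓ (End.asHom (α h))) else 0) = 0 := by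
  rw [← card_stabilizer_mul_card_mul_two_mul_dim_isotypical_restrict_eq_sum ℓ b ρ t₀ α L hcL huL hb hρ hℓ hα e,
    Nat.cast_eq_zero, mul_eq_zero, mul_eq_zero, mul_eq_zero]
  have : Fintype.card (stabilizer G t₀) ≠ 0 := Fintype.card_ne_zero
  have : Fintype.card L ≠ 0 := Fintype.card_ne_zero
  omega

omit [Fact ℓ.Prime] in
/-- **Mackey's formula for the `L`-isotypical components on `Hom(−, B)`** (any field):
**`|H| · |L| · rk_ℤ Hom(B_W^L(Res_L Ind_H^G Y), B) = Σ_{x ∈ G} Σ_{h ∈ H} Σ_{l ∈ L, l = xhx⁻¹} c_W(l) χ_B(α(h))`**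
(`χ_B(u_W) = |L| · rk Hom(Im u_W, B)` since `u_W² = |L| u_W`, `χ_B(u_W) = Σ_l c_W(l) χ_B(ρ(l))`, and the prequel's `Hom`-side
Mackey formula). [cite: SerreLinearRepresentations1977, §7.3 Prop. 22] [cite: LangeRodriguez2022, §2.9.1 Thm. 2.9.1 (PDF p. 43)]
[cite: KaniRosen1989, §2] -/
theorem card_stabilizer_mul_card_mul_finrank_hom_isotypical_restrict_eq_sum (hb : ∑ t, b.π t ≫ b.ι t = 𝟙 b.pt)
    (hρ : ∀ (g : G) (t u : T), g • t ≠ u → b.ι t ≫ End.asHom (ρ g) ≫ b.π u = 0)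
    (hα : ∀ h : stabilizer G t₀, End.asHom (α h) = b.ι t₀ ≫ End.asHom (ρ h) ≫ b.π t₀) (e : ratCharIdempotents L) :
    ((Fintype.card (stabilizer G t₀) * (Fintype.card L * Module.finrank ℤ (image (uL e) ⟶ B)) : ℕ) : ℤ) =
      ∑ x : G, ∑ h : stabilizer G t₀, ∑ l : L, (if (l : G) = x * h * x⁻¹ then
        cL e l * LinearMap.trace ℤ (Y ⟶ B) (Preadditive.leftComp B (End.asHom (α h))).toIntLinearMap else 0) := by
  classical
  set c : G → ℤ := fun g ↦ ∑ l : L, (if (l : G) = g then cL e l else 0) with hc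
  have hcl : ∀ l₀ : L, c l₀ = cL e l₀ := fun l₀ ↦ by
    simp only [hc, SetLike.coe_eq_coe, Finset.sum_ite_eq', Finset.mem_univ, if_true]
  have h1 := trace_leftComp_eq_mul_finrank B (comp_self_eq_card_nsmul_isotypical (ρ.comp L.subtype) hcL huL e)
  have hs : LinearMap.trace ℤ (b.pt ⟶ B) (Preadditive.leftComp B (uL e)).toIntLinearMap =
      ∑ l : L, cL e l *
        LinearMap.trace ℤ (b.pt ⟶ B) (Preadditive.leftComp B (End.asHom ((ρ.comp L.subtype) l))).toIntLinearMap := by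
    rw [isotypical_eq_sum_zsmul_asHom (ρ.comp L.subtype) huL e, trace_leftComp_sum_zsmul]
  have h2 := card_stabilizer_mul_sum_subgroup_mul_trace_leftComp_eq B b ρ t₀ α L hb hρ hα c
  have h3 : ∑ l : L, c l * LinearMap.trace ℤ (b.pt ⟶ B) (Preadditive.leftComp B (End.asHom (ρ l))).toIntLinearMap =
      (Fintype.card L : ℤ) * Module.finrank ℤ (image (uL e) ⟶ B) := by
    rw [← h1, hs]
    exact Finset.sum_congr rfl fun l _ ↦ by rw [hcl]; rfl
  rw [h3] at h2
  push_cast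
  rw [h2]
  refine Finset.sum_congr rfl fun x _ ↦ Finset.sum_congr rfl fun h _ ↦ ?_
  split_ifs with hmem
  · simp only [hc, Finset.sum_mul, ite_mul, zero_mul]
  · symm
    exact Finset.sum_eq_zero fun l _ ↦ if_neg fun (hl : (l : G) = x * h * x⁻¹) ↦ hmem (hl ▸ l.2)

end Isotypical

/-! ## §3 Isogeny forms over a perfect field: `B_H(Res_H Ind_H^G Y) ∼ B_H(Y)^{[G:H]}` and `B_L(Res_L X) ∼ Y^m` -/

section Isogeny

variable [PerfectField K] {Y : AbelianVariety K} {T : Type} [Fintype T] (b : Bicone (fun _ : T ↦ Y))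
  {G : Type} [Group G] [Fintype G] [MulAction G T] [IsPretransitive G T] (ρ : G →* End b.pt) (t₀ : T)
  [Fintype (stabilizer G t₀)] (α : stabilizer G t₀ →* End Y) (L : Subgroup G) [Fintype L]

/-- **`H ⊴ G` ⟹ `B_H(Res_H Ind_H^G Y) ∼ B_H(Y)^{[G : H]}` over a perfect field** (`B_H(X) = Im Σ_{h ∈ H} ρ(h)`,
`B_H(Y) = Im Σ_h α(h)`): "`H_s = H`, `Res_H Ind_H^G W = ⊕_{s ∈ G/H} W_s`" and `(W_s)^H ≅ W^H`; both sides have the same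
`rk Hom(−, B)` for every `B` (`|H| · rk Hom(B_H(X), B) = |G| · rk Hom(B_H(Y), B)`, the prequel), which over a perfect field
characterises the isogeny class. [cite: SerreLinearRepresentations1977, §7.4 Cor. and §7.3 Prop. 22] [cite: KaniRosen1989, §3 Thm. B]
[cite: Milne1986AbelianVarieties, §12 p. 122] -/
theorem isIsogenous_image_norm_restrict_biproduct_of_normal [(stabilizer G t₀).Normal]
    (hb : ∑ t, b.π t ≫ b.ι t = 𝟙 b.pt)
    (hρ : ∀ (g : G) (t u : T), g • t ≠ u → b.ι t ≫ End.asHom (ρ g) ≫ b.π u = 0)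
    (hα : ∀ h : stabilizer G t₀, End.asHom (α h) = b.ι t₀ ≫ End.asHom (ρ h) ≫ b.π t₀)
    {NH' : b.pt ⟶ b.pt} (hNH' : End.of NH' = ∑ h : stabilizer G t₀, ρ h)
    {NH : Y ⟶ Y} (hNH : End.of NH = ∑ h : stabilizer G t₀, α h) :
    IsIsogenous (image NH') (⨁ fun _ : Fin (stabilizer G t₀).index ↦ image NH) := by
  refine isIsogenous_iff_forall_finrank_hom_eq'.2 fun B ↦ ?_
  rw [finrank_hom_biproduct_const, Fintype.card_fin]
  have h := card_stabilizer_mul_finrank_hom_image_norm_restrict_eq_of_normal B b ρ t₀ α hb hρ hα hNH' hNH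
  have hG : Fintype.card G = (stabilizer G t₀).index * Fintype.card (stabilizer G t₀) := by
    rw [← Nat.card_eq_fintype_card, ← Nat.card_eq_fintype_card, Subgroup.index_mul_card]
  rw [hG, mul_comm (stabilizer G t₀).index, mul_assoc] at h
  exact Nat.eq_of_mul_eq_mul_left Fintype.card_pos h

omit [Fintype (stabilizer G t₀)] in
/-- **All `L ∩ xHx⁻¹` trivial ⟹ `B_L(Res_L Ind_H^G Y) ∼ Y^m` over a perfect field, `|T| = |L| · m`** (`L` acts freely on
`T` with `m` orbits; `Res_L X` is a sum of `m` regular powers `Ind_1^L Y`, each with fixed part `∼ Y`):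
`|L| · rk Hom(B_L(X), B) = rk Hom(X, B) = |T| · rk Hom(Y, B)` for every `B` (the prequel).
[cite: SerreLinearRepresentations1977, §7.3 Prop. 22 and §3.3 Example 1] [cite: KaniRosen1989, §3 Thm. B] [cite: Milne1986AbelianVarieties, §12 p. 122] -/
theorem isIsogenous_image_norm_biproduct_of_free [Fintype (stabilizer G t₀)] (hb : ∑ t, b.π t ≫ b.ι t = 𝟙 b.pt)
    (hρ : ∀ (g : G) (t u : T), g • t ≠ u → b.ι t ≫ End.asHom (ρ g) ≫ b.π u = 0)
    (hfree : ∀ (x : G) (h : stabilizer G t₀), x * h * x⁻¹ ∈ L → h = 1)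
    {NL : b.pt ⟶ b.pt} (hNL : End.of NL = ∑ l : L, ρ l) {m : ℕ} (hm : Fintype.card T = Fintype.card L * m) :
    IsIsogenous (image NL) (⨁ fun _ : Fin m ↦ Y) := by
  refine isIsogenous_iff_forall_finrank_hom_eq'.2 fun B ↦ ?_
  rw [finrank_hom_biproduct_const, Fintype.card_fin]
  have h := card_mul_finrank_hom_image_norm_eq_of_free B b ρ t₀ L hb hρ hfree hNL
  rw [finrank_hom_permPower_eq B b hb, hm, mul_assoc] at h
  exact Nat.eq_of_mul_eq_mul_left Fintype.card_pos h

end Isogeny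

end Imprimitive

end AbelianVariety

end Literature.AlgebraicGeometry.Motives
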